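import Literature.Topology.FourManifolds.CircleSurgeryProofs
import Literature.Topology.FourManifolds.CappellShaneson
import HarnessLib

/-!
# The Akbulut–Kirby sphere exists: discharges of the existence facts for Cappell–Shaneson spheres

This file discharges (D-0014) the two remaining *existence* named facts about Cappell–Shaneson
spheres, both immediate corollaries of the general existence theorem
`Literature.Topology.FourManifolds.exists_isCappellShanesonSphereOf_holds` of
`Literature.Topology.FourManifolds.CircleSurgeryProofs` (for every `A ∈ SL(3, ℤ)` with
`det (A - 1) = ±1` there is a closed `C^∞` 4-manifold `X` with `IsCappellShanesonSphereOf A X`: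
the mapping torus of the linear diffeomorphism `torusDiffeomorph A` of `T³`, surgered along the
framed section circle through the fixed point `1 ∈ T³`):

* `exists_isCappellShanesonSphereOf_akbulutKirbyMatrix_holds` — the fact
  `Literature.Topology.FourManifolds.exists_isCappellShanesonSphereOf_akbulutKirbyMatrix` of
  `CircleSurgery.lean`: the Akbulut–Kirby matrix `A₀ = !![0, 1, 0; 0, 1, 1; 1, 0, 1]` has
  `det (A₀ - 1) = 1` (`det_akbulutKirbyMatrix_sub_one`), hence a Cappell–Shaneson sphere
  (Akbulut–Kirby, Topology 24 (1985), §1; it is the case `m = 0` of the family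
  `Aₘ = !![0, 1, 0; 0, 1, 1; 1, 0, m + 1]` of Gompf, Algebr. Geom. Topol. 10 (2010), §1).
* `exists_isCappellShanesonSphere_holds` — the fact
  `Literature.Topology.FourManifolds.exists_isCappellShanesonSphere` of `CappellShaneson.lean`
  (some Cappell–Shaneson sphere exists as a closed smooth 4-manifold), witnessed by `A₀`.

The file lives apart from `CircleSurgeryProofs.lean` only because it also needs
`CappellShaneson.lean` (for `IsCappellShanesonSphere`/`exists_isCappellShanesonSphere`), which is
not in the import closure of the former; `CircleSurgery.lean` itself cannot host the discharges
(its proofs file imports it).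

Sources: S. Akbulut, R. Kirby, *A potential smooth counterexample in dimension 4 to the Poincaré
conjecture, the Schoenflies conjecture, and the Andrews–Curtis conjecture*, Topology 24 (1985),
375–390, §1; S. Cappell, J. Shaneson, *Some new four-manifolds*, Ann. of Math. 104 (1976), §2;
R. Gompf, *More Cappell–Shaneson spheres are standard*, Algebr. Geom. Topol. 10 (2010), §§1–2
("the Cappell-Shaneson homotopy 4-spheres are indexed by a `ℤ/2` framing choice and a conjugacy
class of Cappell-Shaneson matrices `A ∈ SL(3, ℤ)`, defined by the condition `det (A - I) = 1`. The
most thoroughly studied subfamily is given by the matrices `Aₘ` … The first progress in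
trivializing Cappell-Shaneson spheres was due to Akbulut and Kirby [AK1] in 1979, showing via
Kirby calculus that the example with `m = 0` and untwisted framing is `S⁴` … Akbulut and Kirby
worked for 6 years on the `m = 0` case before publishing an elegant handle diagram of it [AK2]";
§2: "Let `X_φ` be the mapping torus `ℝ × M/(t, x) ∼ (t − 1, φ(x))`. Then `ℝ × {p}` descends to a
circle `C ⊂ X_φ` with a canonical framing. For `ε = 0, 1` let `X_φ^ε` be obtained from `X_φ` by
surgery on `C` … The Cappell-Shaneson examples arise when `M` is the 3-torus, so `φ` is obtained
from some `A ∈ SL(3, ℤ)`").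
-/

namespace Literature.Topology.FourManifolds

/-- **Discharge of `exists_isCappellShanesonSphereOf_akbulutKirbyMatrix` (the Akbulut–Kirby
matrix has a Cappell–Shaneson sphere).** The Akbulut–Kirby matrix
`A₀ = !![0, 1, 0; 0, 1, 1; 1, 0, 1] ∈ SL(3, ℤ)` satisfies `det (A₀ - 1) = 1`
(`det_akbulutKirbyMatrix_sub_one`), so the general existence theorem
`exists_isCappellShanesonSphereOf_holds` (mapping torus of `torusDiffeomorph A₀` on `T³`, then
surgery on the framed section circle through the fixed point `1`) produces a closed (compact,
Hausdorff, second countable) `C^∞` 4-manifold `X` with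
`IsCappellShanesonSphereOf akbulutKirbyMatrix X`. This is the homotopy 4-sphere `Σ₀` of
Akbulut–Kirby, Topology 24 (1985), §1 (the Cappell–Shaneson construction for the matrix `A₀`, the
case `m = 0` of the family `Aₘ = !![0, 1, 0; 0, 1, 1; 1, 0, m + 1]`; Gompf, Algebr. Geom. Topol.
10 (2010), §1: "The first progress in trivializing Cappell-Shaneson spheres was due to Akbulut
and Kirby [AK1] in 1979, showing via Kirby calculus that the example with `m = 0` and untwisted
framing is `S⁴` … Akbulut and Kirby worked for 6 years on the `m = 0` case before publishing an
elegant handle diagram of it [AK2]", and §2 for the construction: "Let `X_φ` be the mapping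
torus … `ℝ × {p}` descends to a circle `C ⊂ X_φ` … let `X_φ^ε` be obtained from `X_φ` by surgery
on `C`"). [cite: AkbulutKirby1985, §1] -/
theorem exists_isCappellShanesonSphereOf_akbulutKirbyMatrix_holds :
    exists_isCappellShanesonSphereOf_akbulutKirbyMatrix :=
  exists_isCappellShanesonSphereOf_holds _ (Or.inl det_akbulutKirbyMatrix_sub_one)

/-- **Discharge of `exists_isCappellShanesonSphere` (Cappell–Shaneson spheres exist as closed
smooth 4-manifolds).** The Cappell–Shaneson sphere of the Akbulut–Kirby matrix `A₀`
(`exists_isCappellShanesonSphereOf_akbulutKirbyMatrix_holds`) is a closed (compact, Hausdorff,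
second countable) `C^∞` 4-manifold `X` with `IsCappellShanesonSphere X`; in particular the
statement `CappellShanesonSpheresStandard` is not vacuous (Cappell–Shaneson, Ann. of Math. 104
(1976), §2; Akbulut–Kirby, Topology 24 (1985), §1; Gompf, Algebr. Geom. Topol. 10 (2010), §2).
[cite: AkbulutKirby1985, §1] -/
theorem exists_isCappellShanesonSphere_holds : exists_isCappellShanesonSphere := by
  obtain ⟨X, _, _, _, _, _, _, hX⟩ := exists_isCappellShanesonSphereOf_akbulutKirbyMatrix_holds
  exact ⟨X, ‹_›, ‹_›, ‹_›, ‹_›, ‹_›, ‹_›, akbulutKirbyMatrix, hX⟩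

end Literature.Topology.FourManifolds
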